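import Summits.CriticalPhenomena.PercolationContinuityZ3.Theorems.PercNearOneGluingAdditiveGluingClusterPeel
import Summits.CriticalPhenomena.PercolationContinuityZ3.Theorems.PercNearOneGluingNoHeavyLowerTailWorstPairExchangeCex
import HarnessLib

/-!
# Crux `PercNearOneGluing.AdditiveGluing` (stmt-CriticalPhenomena-4576): the one-relay cluster-peeling kernel with a
# FIXED designation is FALSE — neither "peel the most-attached relay" (MU-A) nor "peel the τ-minimal relay" (MU-τ)
# survives; two certified six-vertex weighted witnesses

Support file (`--supports stmt-CriticalPhenomena-4576`, cell `prim-png-dp-al5` gen 12).  No named facts, no sorries; the `def`s are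
witness data and computable exact-rational checkers (as in `…ClassBoundCex.lean`), the arithmetic is kernel `decide`.

`ClusterPeelMuE.additiveGluing_of_muE` (landed) reduces the crux to the kernel (MU-E): on every finite weighted graph
(`o ∉ A`, `b ∉ A`, `o ≠ b`, `|A| ≥ 3`, `θ ≤ min_A τ`, `τ(a) = μ(a ↔ b)`) SOME relay `d ∈ A` satisfies
  `m1(d) ≥ 0`:  `μ(d ↔ b, d ↮ o, o ↔ A∖d) + θ ≤ τ(d) + Σ_{W ∌ o,b} μ(C(d) = W) · s_W`,  `s_W = min_{A∖W} μ(· ↔ b off W)` (`1` if `A ⊆ W`).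
An induction one can actually run wants a RULE naming `d`.  The two canonical rules are refuted here, each by an exact instance on
`Fin 6` with `o = 0`, `b = 1`, `A = {2,3,4}` and eight weighted pairs (`2⁸` configurations, exact rational counts):
* **(MU-A) "d = the most-attached relay" is false** (`not_muA`): pairs `0–4: 63/64, 0–3: 31/32, 2–5: 19/32, 1–5: 13/32, 4–5: 5/16,
  2–4: 3/16, 2–3: 1/100, 1–3: 5/32`; `μ(o↔4) > μ(o↔3) > μ(o↔2)` (designee `d = 4` unique), `θ = min_A τ = τ(3)`, and
  `m1(4) = −140272317/1717986918400 < 0` (while `m1(3) > 0`: (MU-E) holds there through the τ-minimal, second-most-attached relay).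
  Mechanism: `o` attached almost equally and very strongly to two near-τ-tied relays reaching `b` by different routes (3 directly,
  4 through the hub 5); ttrl2 census `png-mu-exists-designation` (run/shared/lean/ttrl/mu/README.md, OUTER DESIGNATION), found by
  exact adversarial climbs at attachment ties.
* **(MU-τ) "d = the τ-minimal relay" is false** (`not_muTau`): ttrl2's witness W1, pairs `0–3: 1, 0–4: 1/2, 0–5: 9/32, 2–4: 17/32,
  2–5: 17/32, 1–3: 5/32, 1–4: 5/32, 1–5: 15/32`; `τ(2) < τ(3) < τ(4)` (designee `d = 2` unique), `m1(2) = −24204945/2³¹ < 0`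
  (while `m1(3) > 0`, `3` = the most-attached relay).
So no fixed designation among {most attached, τ-minimal} can drive the peeling induction; only the instance-dependent `∃ d` form
(MU-E) (0 violations in ttrl2's 4.1 M exact instances and 7.9 k adversarial climbs, n ≤ 12) is consistent with the data.  The crux
itself is settled independently (`AdditiveGluing_proof`); this file records which peeling kernels a second, inductive proof cannot use.
Infrastructure: `restrW_compl_wOfList` (the residual graph `G − W` of a weighted edge list is the filtered list, so residual
reliabilities are exact counts too), `real_clusterIs` (cluster laws as counts), `real_kernelSum` (the kernel's `W`-sum as a rational).
[cite: KozmaNitzan2024, §3.2 p. 12 (conditioning on C(0) = W); Thm. 1 pp. 7–8]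
-/

namespace Summit.CriticalPhenomena.PercolationContinuityZ3.Theorems

open MeasureTheory
open Literature.Probability.LatticeModels Literature.Probability.Percolation
open Summit.CriticalPhenomena.PercolationContinuityZ3.Theorems.AdditiveGluing.Negative.Cert
open Summit.CriticalPhenomena.PercolationContinuityZ3.Theorems.WorstPairExchangeCex (real_eq_wcount)
open scoped BigOperators

noncomputable section

namespace ClusterPeelMuACex

/-! ### Residual graphs of a weighted edge list -/

/-- The residual weighted edge list `G − W`: the listed pairs with both (distinct) endpoints outside `W`. -/
def residL {n : ℕ} (l : List (Fin n × Fin n × ℚ)) (W : Finset (Fin n)) : List (Fin n × Fin n × ℚ) :=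
  l.filter fun e => decide (e.1 ∉ W) && decide (e.2.1 ∉ W) && decide (e.1 ≠ e.2.1)

/-- **`restrW Wᶜ (wOfList l) = wOfList (G − W)`**: restricting the weights of a weighted edge list off `W` is the weighting
of the filtered list. [this file] -/
theorem restrW_compl_wOfList {n : ℕ} (l : List (Fin n × Fin n × ℚ)) (W : Finset (Fin n)) :
    restrW ((↑W : Set (Fin n))ᶜ) (wOfList l) = wOfList (residL l W) := by
  funext x
  induction l with
  | nil =>
    by_cases hxw : x ∈ wireSet ((↑W : Set (Fin n))ᶜ)
    · rw [restrW_apply_of_mem _ hxw]; rfl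
    · rw [restrW_apply_of_not_mem _ hxw]; rfl
  | cons e l ih =>
    have hres : residL (e :: l) W =
        if (decide (e.1 ∉ W) && decide (e.2.1 ∉ W) && decide (e.1 ≠ e.2.1)) = true then e :: residL l W
        else residL l W := by
      simp only [residL, List.filter_cons]
    by_cases hc : (decide (e.1 ∉ W) && decide (e.2.1 ∉ W) && decide (e.1 ≠ e.2.1)) = true
    · rw [hres, if_pos hc]
      by_cases hx : x = mkE (e.1, e.2.1)
      · have hxw : x ∈ wireSet ((↑W : Set (Fin n))ᶜ) := by
          simp only [Bool.and_eq_true, decide_eq_true_eq] at hc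
          rw [hx, mkE, mk_mem_wireSet_iff]
          exact ⟨fun h => hc.1.1 (Finset.mem_coe.1 h), fun h => hc.1.2 (Finset.mem_coe.1 h), hc.2⟩
        rw [restrW_apply_of_mem _ hxw]
        simp only [wOfList, hx, if_true]
      · by_cases hxw : x ∈ wireSet ((↑W : Set (Fin n))ᶜ)
        · rw [restrW_apply_of_mem _ hxw]
          simp only [wOfList, if_neg hx]
          rw [← ih, restrW_apply_of_mem _ hxw]
        · rw [restrW_apply_of_not_mem _ hxw]
          simp only [wOfList, if_neg hx]
          rw [← ih, restrW_apply_of_not_mem _ hxw]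
    · rw [hres, if_neg hc]
      by_cases hxw : x ∈ wireSet ((↑W : Set (Fin n))ᶜ)
      · have hx : x ≠ mkE (e.1, e.2.1) := by
          intro hx
          rw [hx, mkE, mk_mem_wireSet_iff, Set.mem_compl_iff, Set.mem_compl_iff, Finset.mem_coe, Finset.mem_coe] at hxw
          exact hc (by simp only [Bool.and_eq_true, decide_eq_true_eq]; exact ⟨⟨hxw.1, hxw.2.1⟩, hxw.2.2⟩)
        rw [restrW_apply_of_mem _ hxw]
        simp only [wOfList, if_neg hx]
        rw [← ih, restrW_apply_of_mem _ hxw]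
      · rw [restrW_apply_of_not_mem _ hxw, ← ih, restrW_apply_of_not_mem _ hxw]

/-- The residual list has distinct pairs if the list has. [this file] -/
theorem residL_nodup {n : ℕ} {l : List (Fin n × Fin n × ℚ)} (hnd : (wPairs l).Nodup) (W : Finset (Fin n)) :
    (wPairs (residL l W)).Nodup :=
  (List.Sublist.map _ (List.filter_sublist (l := l))).nodup hnd

/-- The residual list has weights in `[0,1]` if the list has. [this file] -/
theorem residL_weights {n : ℕ} {l : List (Fin n × Fin n × ℚ)} (hq : ∀ e ∈ l, 0 ≤ e.2.2 ∧ e.2.2 ≤ 1)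
    (W : Finset (Fin n)) : ∀ e ∈ residL l W, 0 ≤ e.2.2 ∧ e.2.2 ≤ 1 :=
  fun e he => hq e (List.mem_of_mem_filter he)

/-- **Residual reliabilities are exact counts**: `μ(a ↔ b off W) = wConn` of the residual list (`a ∉ W`). [this file] -/
theorem real_openConnIn_compl {n : ℕ} {l : List (Fin n × Fin n × ℚ)} (hnd : (wPairs l).Nodup)
    (hq : ∀ e ∈ l, 0 ≤ e.2.2 ∧ e.2.2 ≤ 1) (W : Finset (Fin n)) {a : Fin n} (ha : a ∉ W) (b : Fin n) :
    (prodBernoulli (wOfList l)).real (openConnIn ((↑W : Set (Fin n))ᶜ) a b) =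
      (wConn (wtabs n (residL l W)) a b : ℝ) := by
  rw [← ClusterPeel.restr_real_openConn (wOfList l) W ha b, restrW_compl_wOfList,
    real_openConn_eq_wConn (residL_nodup hnd W) (residL_weights hq W)]

/-! ### Exact counts on six vertices: cluster laws, the kernel's right-hand event, the residual minimum -/

/-- Exact weighted count of a `Bool` test on reach tables over the sub-configurations of `l`. -/
def cntL (l : List (Fin 6 × Fin 6 × ℚ)) (f : List ℕ → Bool) : ℚ := ((wtabs 6 l).map fun t => if f t.1 then t.2 else 0).sum

/-- Reach bit `x ↔ y` of a reach table. -/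
def cb (tb : List ℕ) (x y : Fin 6) : Bool := (tb.getD x 0).testBit y

/-- Test of the cluster event `C(d) = W` (row `d` of the reach table is exactly `W`). -/
def fCl (d : Fin 6) (W : Finset (Fin 6)) (tb : List ℕ) : Bool := decide (∀ y : Fin 6, cb tb d y = true ↔ y ∈ W)

/-- Test of the kernel's right-hand event `{d ↔ 1} ∩ {d ↮ 0} ∩ ⋃_{a ∈ {2,3,4} ∖ d} {0 ↔ a}` (`o = 0`, `b = 1`). -/
def fRhs (d : Fin 6) (tb : List ℕ) : Bool :=
  cb tb d 1 && !cb tb d 0 && decide (∃ a ∈ (({2, 3, 4} : Finset (Fin 6)).erase d), cb tb 0 a = true)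

/-- The residual minimum `s_W = min_{a ∈ {2,3,4} ∖ W} μ(a ↔ 1 off W)` (`1` if empty) as an exact rational. -/
def sQ (l : List (Fin 6 × Fin 6 × ℚ)) (W : Finset (Fin 6)) : ℚ :=
  if h : (({2, 3, 4} : Finset (Fin 6)) \ W).Nonempty then
    (({2, 3, 4} : Finset (Fin 6)) \ W).inf' h (fun a => wConn (wtabs 6 (residL l W)) a 1) else 1

/-- The kernel's `W`-sum `Σ_{W ∌ 0,1, W ∋ d} μ(C(d) = W) · s_W` as an exact rational. -/
def kerSumQ (l : List (Fin 6 × Fin 6 × ℚ)) (d : Fin 6) : ℚ :=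
  ∑ W ∈ Finset.univ.filter (fun W : Finset (Fin 6) => (0 : Fin 6) ∉ W ∧ (1 : Fin 6) ∉ W ∧ d ∈ W), cntL l (fCl d W) * sQ l W

variable {l : List (Fin 6 × Fin 6 × ℚ)} (hnd : (wPairs l).Nodup) (hq : ∀ e ∈ l, 0 ≤ e.2.2 ∧ e.2.2 ≤ 1)
include hnd hq

/-- Cluster laws are exact counts: `μ(C(d) = W) = cntL l (fCl d W)`. [this file] -/
theorem real_clusterIs (d : Fin 6) (W : Finset (Fin 6)) :
    (prodBernoulli (wOfList l)).real (clusterIs d W) = (cntL l (fCl d W) : ℝ) := by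
  refine real_eq_wcount hnd hq (fCl d W) _ fun ω => ?_
  simp only [fCl, cb, decide_eq_true_eq, testBit_reachTable_iff_mem_openConn]
  simp only [clusterIs, openCluster, openConn, Set.mem_setOf_eq, Set.ext_iff, Finset.mem_coe]

/-- The kernel's right-hand event is an exact count. [this file] -/
theorem real_rhs (d : Fin 6) :
    (prodBernoulli (wOfList l)).real (openConn d (1 : Fin 6) ∩ (openConn d (0 : Fin 6))ᶜ ∩
        ⋃ a ∈ (({2, 3, 4} : Finset (Fin 6)).erase d), openConn (0 : Fin 6) a) = (cntL l (fRhs d) : ℝ) := by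
  refine real_eq_wcount hnd hq (fRhs d) _ fun ω => ?_
  simp only [fRhs, cb, Bool.and_eq_true, Bool.not_eq_true', decide_eq_true_eq, Set.mem_inter_iff, Set.mem_compl_iff,
    Set.mem_iUnion, exists_prop]
  simp only [← testBit_reachTable_iff_mem_openConn, Bool.not_eq_true]

/-- The residual minimum of the kernel is the exact rational `sQ`. [this file] -/
theorem real_sW (W : Finset (Fin 6)) :
    (if h : (({2, 3, 4} : Finset (Fin 6)) \ W).Nonempty then
        (({2, 3, 4} : Finset (Fin 6)) \ W).inf' h
          (fun a => (prodBernoulli (wOfList l)).real (openConnIn ((↑W : Set (Fin 6))ᶜ) a (1 : Fin 6)))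
      else (1 : ℝ)) = (sQ l W : ℝ) := by
  unfold sQ
  split_ifs with h
  · rw [Finset.inf'_congr h rfl (fun a ha => real_openConnIn_compl hnd hq W (Finset.mem_sdiff.1 ha).2 (1 : Fin 6)),
      Finset.apply_inf'_eq_inf'_comp h (fun q : ℚ => (q : ℝ)) (fun x y => Rat.cast_min x y)]
    rfl
  · simp

/-- **The kernel's `W`-sum is the exact rational `kerSumQ`** (terms with `d ∉ W` vanish since `d ∈ C(d)`). [this file] -/
theorem real_kernelSum (d : Fin 6) :
    ∑ W ∈ Finset.univ.filter (fun W : Finset (Fin 6) => (0 : Fin 6) ∉ W ∧ (1 : Fin 6) ∉ W),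
        (prodBernoulli (wOfList l)).real (clusterIs d W) *
          (if h : (({2, 3, 4} : Finset (Fin 6)) \ W).Nonempty then
              (({2, 3, 4} : Finset (Fin 6)) \ W).inf' h
                (fun a => (prodBernoulli (wOfList l)).real (openConnIn ((↑W : Set (Fin 6))ᶜ) a (1 : Fin 6)))
            else 1) = (kerSumQ l d : ℝ) := by
  have hsub : Finset.univ.filter (fun W : Finset (Fin 6) => (0 : Fin 6) ∉ W ∧ (1 : Fin 6) ∉ W ∧ d ∈ W) ⊆
      Finset.univ.filter (fun W : Finset (Fin 6) => (0 : Fin 6) ∉ W ∧ (1 : Fin 6) ∉ W) := by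
    intro W hW
    simp only [Finset.mem_filter, Finset.mem_univ, true_and] at hW ⊢
    exact ⟨hW.1, hW.2.1⟩
  rw [← Finset.sum_subset hsub]
  · rw [kerSumQ, Rat.cast_sum]
    refine Finset.sum_congr rfl fun W _ => ?_
    rw [real_clusterIs hnd hq, real_sW hnd hq, Rat.cast_mul]
  · intro W hW hW'
    simp only [Finset.mem_filter, Finset.mem_univ, true_and, not_and] at hW hW'
    have hdW : d ∉ W := hW' hW.1 hW.2
    have hempty : (clusterIs d W : Set (BondConfig (Fin 6))) = ∅ := by
      ext ω
      simp only [clusterIs, Set.mem_setOf_eq, Set.mem_empty_iff_false, iff_false]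
      intro hC
      have : d ∈ (↑W : Set (Fin 6)) := hC ▸ mem_openCluster_self ω d
      exact hdW (Finset.mem_coe.1 this)
    rw [hempty, measureReal_empty, zero_mul]

/-- **Reduction.** For a weighted edge list `l` on `Fin 6` (`o = 0`, `b = 1`, `A = {2,3,4}`) and a relay `d ∈ A`: if the decided rational
fact `τ(d) + kerSumQ < cntL(fRhs d) + τ(a₀)` holds (`a₀ ∈ A` a τ-minimiser, so `θ = τ(a₀)` is admissible), then the (MU-E) kernel
inequality FAILS at `d` with `θ = τ(a₀)`. [this file] -/
theorem kernel_fails_of_checks (d a₀ : Fin 6)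
    (hlt : wConn (wtabs 6 l) d 1 + kerSumQ l d < cntL l (fRhs d) + wConn (wtabs 6 l) a₀ 1) :
    ¬ ((prodBernoulli (wOfList l)).real (openConn d (1 : Fin 6) ∩ (openConn d (0 : Fin 6))ᶜ ∩
          ⋃ a ∈ (({2, 3, 4} : Finset (Fin 6)).erase d), openConn (0 : Fin 6) a) +
          (prodBernoulli (wOfList l)).real (openConn a₀ (1 : Fin 6)) ≤
        (prodBernoulli (wOfList l)).real (openConn d (1 : Fin 6)) +
          ∑ W ∈ Finset.univ.filter (fun W : Finset (Fin 6) => (0 : Fin 6) ∉ W ∧ (1 : Fin 6) ∉ W),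
            (prodBernoulli (wOfList l)).real (clusterIs d W) *
              (if h : (({2, 3, 4} : Finset (Fin 6)) \ W).Nonempty then
                  (({2, 3, 4} : Finset (Fin 6)) \ W).inf' h
                    (fun a => (prodBernoulli (wOfList l)).real (openConnIn ((↑W : Set (Fin 6))ᶜ) a (1 : Fin 6)))
                else 1)) := by
  rw [real_rhs hnd hq, real_kernelSum hnd hq, real_openConn_eq_wConn hnd hq, real_openConn_eq_wConn hnd hq, not_le]
  exact_mod_cast hlt

end ClusterPeelMuACex

/-! ### Witness 1: the most-attached designation (MU-A) fails -/

namespace ClusterPeelMuACex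

/-- The (MU-A) witness on `Fin 6` (`o = 0`, `b = 1`, `A = {2,3,4}`, hub `5`):
`0–4: 63/64, 0–3: 31/32, 2–5: 19/32, 1–5: 13/32, 4–5: 5/16, 2–4: 3/16, 2–3: 1/100, 1–3: 5/32`. -/
def witA : List (Fin 6 × Fin 6 × ℚ) :=
  [(0, 4, 63/64), (0, 3, 31/32), (2, 5, 19/32), (1, 5, 13/32), (4, 5, 5/16), (2, 4, 3/16), (2, 3, 1/100), (1, 3, 5/32)]

/-- The listed pairs of `witA` are distinct. [this file] -/
theorem witA_nodup : (wPairs witA).Nodup := by decide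

/-- The weights of `witA` lie in `[0,1]`. [this file] -/
theorem witA_weights : ∀ e ∈ witA, 0 ≤ e.2.2 ∧ e.2.2 ≤ 1 := by
  intro e he
  simp only [witA, List.mem_cons, List.not_mem_nil, or_false] at he
  rcases he with rfl | rfl | rfl | rfl | rfl | rfl | rfl | rfl <;> norm_num

/-- Decided facts at `witA`: `τ(3) < τ(4) < τ(2)` (so `θ = τ(3) = min_A τ`), `μ(o↔2) < μ(o↔3) < μ(o↔4)` (designee `4` unique),
and the kernel check fails at `d = 4`: `τ(4) + kerSumQ < cntL fRhs + τ(3)` (margin `m1(4) = −140272317/1717986918400`). [this file] -/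
theorem witA_facts :
    wConn (wtabs 6 witA) 3 1 < wConn (wtabs 6 witA) 4 1 ∧ wConn (wtabs 6 witA) 4 1 < wConn (wtabs 6 witA) 2 1 ∧
    wConn (wtabs 6 witA) 0 2 < wConn (wtabs 6 witA) 0 3 ∧ wConn (wtabs 6 witA) 0 3 < wConn (wtabs 6 witA) 0 4 ∧
    wConn (wtabs 6 witA) 4 1 + kerSumQ witA 4 < cntL witA (fRhs 4) + wConn (wtabs 6 witA) 3 1 := by
  decide +kernel

/-- At `witA` the (MU-E) kernel HOLDS at the τ-minimal relay `d = 3` (margin `m1(3) = 114038883/1717986918400 > 0`): the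
`∃ d` form survives where the most-attached rule fails. [this file] -/
theorem witA_muE_d3 :
    cntL witA (fRhs 3) + wConn (wtabs 6 witA) 3 1 ≤ wConn (wtabs 6 witA) 3 1 + kerSumQ witA 3 := by
  decide +kernel

end ClusterPeelMuACex

open ClusterPeelMuACex in
/-- **(MU-A) is FALSE: the one-relay cluster-peeling kernel fails at the most-attached relay.**  (MU-A) — "on every finite weighted
graph (`o ∉ A`, `b ∉ A`, `o ≠ b`, `|A| ≥ 3`, `θ ≤ min_A μ(· ↔ b)`), EVERY relay `d ∈ A` maximising the attachment `μ(o ↔ ·)` satisfies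
`μ(d ↔ b, d ↮ o, o ↔ A∖d) + θ ≤ μ(d ↔ b) + Σ_{W ∌ o,b} μ(C(d) = W) · s_W`, `s_W = min_{A∖W} μ(· ↔ b off W)` (`1` if `A ⊆ W`)" — i.e.
the (MU-E) kernel of `ClusterPeelMuE.additiveGluing_of_muE` with the instance-dependent `∃ d ∈ A` replaced by the rule "most attached".
Refuted at `witA` with `d = 4` (the UNIQUE maximiser, so every tie-breaking variant fails too) and `θ = τ(3) = min_A τ`:
margin `−140272317/1717986918400 ≈ −8.2·10⁻⁵` (ttrl2 census `png-mu-exists-designation`, exact). [this file] -/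
theorem not_muA :
    ¬ (∀ (n : ℕ) (w : Sym2 (Fin n) → unitInterval) (A : Finset (Fin n)) (o b : Fin n) (θ : ℝ),
      o ∉ A → b ∉ A → o ≠ b → 3 ≤ A.card → (∀ a ∈ A, θ ≤ (prodBernoulli w).real (openConn a b)) →
      ∀ d ∈ A, (∀ a ∈ A, (prodBernoulli w).real (openConn o a) ≤ (prodBernoulli w).real (openConn o d)) →
        (prodBernoulli w).real (openConn d b ∩ (openConn d o)ᶜ ∩ (⋃ a ∈ A.erase d, openConn o a)) + θ ≤
        (prodBernoulli w).real (openConn d b) +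
          ∑ W ∈ Finset.univ.filter (fun W : Finset (Fin n) => o ∉ W ∧ b ∉ W),
            (prodBernoulli w).real (clusterIs d W) *
              (if h : (A \ W).Nonempty then
                  (A \ W).inf' h (fun a => (prodBernoulli w).real (openConnIn ((↑W : Set (Fin n))ᶜ) a b))
               else 1)) := by
  intro h
  obtain ⟨h34, h42, h23, h34', hlt⟩ := witA_facts
  have hθ : ∀ a ∈ ({2, 3, 4} : Finset (Fin 6)),
      (prodBernoulli (wOfList witA)).real (openConn (3 : Fin 6) (1 : Fin 6)) ≤
        (prodBernoulli (wOfList witA)).real (openConn a (1 : Fin 6)) := by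
    intro a ha
    rw [real_openConn_eq_wConn witA_nodup witA_weights, real_openConn_eq_wConn witA_nodup witA_weights]
    simp only [Finset.mem_insert, Finset.mem_singleton] at ha
    rcases ha with rfl | rfl | rfl
    · exact_mod_cast (h34.trans h42).le
    · exact le_rfl
    · exact_mod_cast h34.le
  have hatt : ∀ a ∈ ({2, 3, 4} : Finset (Fin 6)),
      (prodBernoulli (wOfList witA)).real (openConn (0 : Fin 6) a) ≤
        (prodBernoulli (wOfList witA)).real (openConn (0 : Fin 6) (4 : Fin 6)) := by
    intro a ha
    rw [real_openConn_eq_wConn witA_nodup witA_weights, real_openConn_eq_wConn witA_nodup witA_weights]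
    simp only [Finset.mem_insert, Finset.mem_singleton] at ha
    rcases ha with rfl | rfl | rfl
    · exact_mod_cast (h23.trans h34').le
    · exact_mod_cast h34'.le
    · exact le_rfl
  exact kernel_fails_of_checks witA_nodup witA_weights 4 3 hlt
    (h 6 (wOfList witA) {2, 3, 4} 0 1 _ (by decide) (by decide) (by decide) (by decide) hθ 4 (by decide) hatt)

/-! ### Witness 2: the τ-minimal designation (MU-τ) fails -/

namespace ClusterPeelMuACex

/-- ttrl2's witness W1 on `Fin 6` (`o = 0`, `b = 1`, `A = {2,3,4}`):
`0–3: 1, 0–4: 1/2, 0–5: 9/32, 2–4: 17/32, 2–5: 17/32, 1–3: 5/32, 1–4: 5/32, 1–5: 15/32`. -/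
def witT : List (Fin 6 × Fin 6 × ℚ) :=
  [(0, 3, 1), (0, 4, 1/2), (0, 5, 9/32), (2, 4, 17/32), (2, 5, 17/32), (1, 3, 5/32), (1, 4, 5/32), (1, 5, 15/32)]

/-- The listed pairs of `witT` are distinct. [this file] -/
theorem witT_nodup : (wPairs witT).Nodup := by decide

/-- The weights of `witT` lie in `[0,1]`. [this file] -/
theorem witT_weights : ∀ e ∈ witT, 0 ≤ e.2.2 ∧ e.2.2 ≤ 1 := by
  intro e he
  simp only [witT, List.mem_cons, List.not_mem_nil, or_false] at he
  rcases he with rfl | rfl | rfl | rfl | rfl | rfl | rfl | rfl <;> norm_num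

/-- Decided facts at `witT`: `τ(2) < τ(3) < τ(4)` (designee `2` unique, `θ = τ(2)`), and the kernel check fails at `d = 2`:
`τ(2) + kerSumQ < cntL fRhs + τ(2)` (margin `m1(2) = −24204945/2³¹`). [this file] -/
theorem witT_facts :
    wConn (wtabs 6 witT) 2 1 < wConn (wtabs 6 witT) 3 1 ∧ wConn (wtabs 6 witT) 3 1 < wConn (wtabs 6 witT) 4 1 ∧
    wConn (wtabs 6 witT) 2 1 + kerSumQ witT 2 < cntL witT (fRhs 2) + wConn (wtabs 6 witT) 2 1 := by
  decide +kernel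

/-- At `witT` the (MU-E) kernel HOLDS at the most-attached relay `d = 3` (margin `m1(3) = 2039055/2³¹ > 0`). [this file] -/
theorem witT_muE_d3 :
    cntL witT (fRhs 3) + wConn (wtabs 6 witT) 2 1 ≤ wConn (wtabs 6 witT) 3 1 + kerSumQ witT 3 := by
  decide +kernel

end ClusterPeelMuACex

open ClusterPeelMuACex in
/-- **(MU-τ) is FALSE: the one-relay cluster-peeling kernel fails at the τ-minimal relay.**  (MU-τ) — the (MU-E) kernel of
`ClusterPeelMuE.additiveGluing_of_muE` demanded at EVERY relay `d ∈ A` minimising `τ = μ(· ↔ b)` (the lead's original designation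
(MU)).  Refuted at ttrl2's witness W1 (`witT`) with `d = 2` (the UNIQUE minimiser) and `θ = τ(2)`: margin `−24204945/2³¹ ≈ −1.1·10⁻²`
(run/shared/lean/ttrl/mu/README.md, RESULT R0, exact). [this file] -/
theorem not_muTau :
    ¬ (∀ (n : ℕ) (w : Sym2 (Fin n) → unitInterval) (A : Finset (Fin n)) (o b : Fin n) (θ : ℝ),
      o ∉ A → b ∉ A → o ≠ b → 3 ≤ A.card → (∀ a ∈ A, θ ≤ (prodBernoulli w).real (openConn a b)) →
      ∀ d ∈ A, (∀ a ∈ A, (prodBernoulli w).real (openConn d b) ≤ (prodBernoulli w).real (openConn a b)) →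
        (prodBernoulli w).real (openConn d b ∩ (openConn d o)ᶜ ∩ (⋃ a ∈ A.erase d, openConn o a)) + θ ≤
        (prodBernoulli w).real (openConn d b) +
          ∑ W ∈ Finset.univ.filter (fun W : Finset (Fin n) => o ∉ W ∧ b ∉ W),
            (prodBernoulli w).real (clusterIs d W) *
              (if h : (A \ W).Nonempty then
                  (A \ W).inf' h (fun a => (prodBernoulli w).real (openConnIn ((↑W : Set (Fin n))ᶜ) a b))
               else 1)) := by
  intro h
  obtain ⟨h23, h34, hlt⟩ := witT_facts
  have hτ : ∀ a ∈ ({2, 3, 4} : Finset (Fin 6)),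
      (prodBernoulli (wOfList witT)).real (openConn (2 : Fin 6) (1 : Fin 6)) ≤
        (prodBernoulli (wOfList witT)).real (openConn a (1 : Fin 6)) := by
    intro a ha
    rw [real_openConn_eq_wConn witT_nodup witT_weights, real_openConn_eq_wConn witT_nodup witT_weights]
    simp only [Finset.mem_insert, Finset.mem_singleton] at ha
    rcases ha with rfl | rfl | rfl
    · exact le_rfl
    · exact_mod_cast h23.le
    · exact_mod_cast (h23.trans h34).le
  exact kernel_fails_of_checks witT_nodup witT_weights 2 2 hlt
    (h 6 (wOfList witT) {2, 3, 4} 0 1 _ (by decide) (by decide) (by decide) (by decide) hτ 2 (by decide) hτ)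

end

end Summit.CriticalPhenomena.PercolationContinuityZ3.Theorems
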